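import Summits.Ventures.YMGap.YM3IR.AxialPairFibre
import HarnessLib

/-!
# YM₃ infrared statement — exact conditional expectations given the axial `b = 2` coarse variable
(track Y4, cell `pub-ymgap`; ym3ir-theory-2, gen 6)

HONEST FRAMING.  WHAT THIS IS: a venture file of abstract HAAR-MEASURE identities continuing
`YM3IR/AxialPairFibre.lean` (pair parametrisation `axialPairParam v u = (u, u⁻¹ v)` of the fibre `{u₁ u₂ = v}`
of the axial `b = 2` block constraint).  For a left-invariant probability measure `μ` on a measurable group `G`
(read: Haar on `SU(N)`) and the pair law `μ ⊗ μ` of the two fine links of one axial line we prove the BOCHNER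
forms of the disintegration along the product map — `∫ f d(μ ⊗ μ) = ∫ dμ(v) ∫ dμ(u) f(u, u⁻¹ v)`
(`integral_prod_eq_integral_axialPairParam`) and `E[φ(u₁u₂) f(u₁,u₂)] = ∫ φ(v) Ψ_f(v) dμ(v)` for bounded `φ`
(`integral_mul_comp_mul_eq`) with the FIBRE AVERAGE `Ψ_f(v) = axialPairAverage μ f v = ∫ f(u, u⁻¹ v) dμ(u)` —
and the object clause (b)(ii) of the infrared conjecture is about, for one line: the EXACT CONDITIONAL
EXPECTATION given the coarse variable, `E_{μ⊗μ}[f | σ(u₁u₂)] = Ψ_f ∘ (u₁u₂)` almost surely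
(`condExp_mul_ae_eq_axialPairAverage`), by the disintegration and the law `μ` of the product
(`map_mul_prod_eq_self`).  The proof transcribes theory-2's forest disintegration
(`YM3IR/ForestDisintegration.lean`, `condExp_forest_ae_eq_forestAverage`) with (forest gauge fixing, star
decimation) replaced by (first link, ordered product).  WHAT THIS IS NOT: one line only — the torus statement
(product over the axial lines of `axialFamily 2` and the free links, then the Wilson density) is the next file;
no estimate, no Dobrushin constant, no clustering claim, no new conjecture name; nothing about the continuum
limit, `d = 4`, or the Clay problem.

WHY THIS IS NOVEL (one sentence): it puts in the kernel, for the covariant block-averaging family of CMP 98 at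
`b = 2`, the exact fibre-average formula for conditional expectations given the block variable — the formula
through which a high-temperature (Dobrushin) estimate on the one-parameter fibres becomes clause (b) of the
infrared conjecture, with no equivalence-of-ensembles step.

References: P. R. Halmos, Measure Theory, §59 (shear transformations); T. Bałaban, CMP 98 (1985) (15) p. 19
[cite: Balaban1985Averaging, (15) p.19]; cell files ym3ir/YM3-IR-theory2.md §12.F–G.
-/

noncomputable section

open MeasureTheory
open scoped ENNReal

namespace Summit.Ventures.YMGap.YM3IR

variable {G : Type*} [Group G]

/-- Reconstruction: the pair is recovered from its first link and its ordered product,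
`axialPairParam (u₁ u₂) u₁ = (u₁, u₂)`. [folklore] -/
@[simp] theorem axialPairParam_fst_mul (z : G × G) : axialPairParam (z.1 * z.2) z.1 = z :=
  Prod.ext rfl (inv_mul_cancel_left z.1 z.2)

variable [MeasurableSpace G] [MeasurableMul₂ G] [MeasurableInv G]

/-- **The fibre average** of an observable of the pair over the fibre of the coarse value `v`, against the
parameter's law `μ`: `Ψ_f(v) = ∫ f(u, u⁻¹ v) dμ(u)`. [folklore] -/
def axialPairAverage (μ : Measure G) (f : G × G → ℝ) (v : G) : ℝ :=
  ∫ u, f (axialPairParam v u) ∂μ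

omit [MeasurableInv G] in
/-- The map `(u₁, u₂) ↦ (u₁, u₁ u₂)` (first link, ordered product) preserves `μ ⊗ μ` (Halmos's shear `S`;
Mathlib `measurePreserving_prod_mul`). [folklore] -/
theorem measurePreserving_fst_mul (μ : Measure G) [SFinite μ] [μ.IsMulLeftInvariant] :
    MeasurePreserving (fun z : G × G => (z.1, z.1 * z.2)) (μ.prod μ) (μ.prod μ) :=
  measurePreserving_prod_mul μ μ

/-- An integrable observable of the pair, read through the parametrisation `(u, v) ↦ (u, u⁻¹ v)`, is integrable
for `μ ⊗ μ`. [folklore] -/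
theorem integrable_comp_axialPairParam (μ : Measure G) [SFinite μ] [μ.IsMulLeftInvariant]
    {f : G × G → ℝ} (hfi : Integrable f (μ.prod μ)) :
    Integrable (fun p : G × G => f (axialPairParam p.2 p.1)) (μ.prod μ) :=
  ((measurePreserving_axialPairParam μ).integrable_comp hfi.aestronglyMeasurable).mpr hfi

/-- BOCHNER DISINTEGRATION of `μ ⊗ μ` along the product map:
`∫ f d(μ ⊗ μ) = ∫ dμ(v) ∫ dμ(u) f(u, u⁻¹ v)` for integrable `f`. [folklore] -/
theorem integral_prod_eq_integral_axialPairParam (μ : Measure G) [SFinite μ] [μ.IsMulLeftInvariant]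
    (f : G × G → ℝ) (hfi : Integrable f (μ.prod μ)) :
    ∫ z, f z ∂(μ.prod μ) = ∫ v, ∫ u, f (axialPairParam v u) ∂μ ∂μ := by
  have hΦ := measurePreserving_axialPairParam μ
  have hFi := integrable_comp_axialPairParam μ hfi
  calc ∫ z, f z ∂(μ.prod μ)
      = ∫ z, f z ∂((μ.prod μ).map (fun z : G × G => axialPairParam z.2 z.1)) := by rw [hΦ.map_eq]
    _ = ∫ z, f (axialPairParam z.2 z.1) ∂(μ.prod μ) := by
        refine integral_map hΦ.measurable.aemeasurable ?_
        rw [hΦ.map_eq]; exact hfi.aestronglyMeasurable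
    _ = ∫ v, ∫ u, f (axialPairParam v u) ∂μ ∂μ :=
        integral_prod_symm (fun z : G × G => f (axialPairParam z.2 z.1)) hFi

/-- The fibre average is the inner integral of the disintegration: `∫ f d(μ ⊗ μ) = ∫ Ψ_f dμ`. [folklore] -/
theorem integral_prod_eq_integral_axialPairAverage (μ : Measure G) [SFinite μ] [μ.IsMulLeftInvariant]
    (f : G × G → ℝ) (hfi : Integrable f (μ.prod μ)) :
    ∫ z, f z ∂(μ.prod μ) = ∫ v, axialPairAverage μ f v ∂μ :=
  integral_prod_eq_integral_axialPairParam μ f hfi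

/-- CONDITIONAL FORM: `E[φ(u₁ u₂) f(u₁, u₂)] = ∫ φ(v) Ψ_f(v) dμ(v)` for integrable `f` and bounded measurable
`φ` of the coarse variable. [folklore] -/
theorem integral_mul_comp_mul_eq (μ : Measure G) [SFinite μ] [μ.IsMulLeftInvariant]
    {f : G × G → ℝ} (hfi : Integrable f (μ.prod μ)) {φ : G → ℝ} (hφm : Measurable φ)
    {C : ℝ} (hφb : ∀ v, |φ v| ≤ C) :
    ∫ z, φ (z.1 * z.2) * f z ∂(μ.prod μ) = ∫ v, φ v * axialPairAverage μ f v ∂μ := by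
  have hgi : Integrable (fun z : G × G => φ (z.1 * z.2) * f z) (μ.prod μ) := by
    refine hfi.bdd_mul (c := C) ((hφm.comp measurable_mul).aestronglyMeasurable) ?_
    exact Filter.Eventually.of_forall fun z => by
      simpa [Real.norm_eq_abs] using hφb (z.1 * z.2)
  rw [integral_prod_eq_integral_axialPairParam μ _ hgi]
  refine integral_congr_ae (Filter.Eventually.of_forall fun v => ?_)
  simp only [axialPairParam_fst_mul_snd, axialPairAverage]
  exact integral_const_mul (φ v) _

/-- **EXACT CONDITIONAL EXPECTATIONS GIVEN THE COARSE VARIABLE** (one axial line, `b = 2`): for a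
left-invariant probability `μ` and every integrable measurable `f` on the pair,
`E_{μ⊗μ}[f | σ(u₁u₂)] = Ψ_f ∘ (u₁u₂)` almost surely.  No smallness is used: disintegration of `μ ⊗ μ` along
the product map (`AxialPairFibre`) and the law `μ` of the product. [folklore] -/
theorem condExp_mul_ae_eq_axialPairAverage (μ : Measure G) [IsProbabilityMeasure μ] [μ.IsMulLeftInvariant]
    {f : G × G → ℝ} (hfm : Measurable f) (hfi : Integrable f (μ.prod μ)) :
    condExp (MeasurableSpace.comap (fun z : G × G => z.1 * z.2) inferInstance) (μ.prod μ) f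
      =ᵐ[μ.prod μ] fun z => axialPairAverage μ f (z.1 * z.2) := by
  set μ2 : Measure (G × G) := μ.prod μ with hμ2
  have hmul : Measurable (fun z : G × G => z.1 * z.2) := measurable_mul
  have hpair : Measurable (fun z : G × G => (z.1, z.1 * z.2)) := measurable_fst.prodMk hmul
  have hT : Measurable (fun p : G × G => axialPairParam p.2 p.1) := measurable_axialPairParam_uncurry
  have hJ : μ2.map (fun z : G × G => (z.1, z.1 * z.2)) = μ2 := (measurePreserving_fst_mul μ).map_eq
  have hsdπ : μ2.map (fun z : G × G => z.1 * z.2) = μ := map_mul_prod_eq_self μ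
  -- the observable read through the reconstruction map `(a, s) ↦ (a, a⁻¹ s)`
  set F : G × G → ℝ := fun p => f (axialPairParam p.2 p.1) with hF_def
  have hF : Measurable F := hfm.comp hT
  have hrec : ∀ z : G × G, F (z.1, z.1 * z.2) = f z := fun z => by
    simp only [hF_def, axialPairParam_fst_mul]
  have hFJ : Integrable F μ2 := by
    rw [← hJ]
    refine (integrable_map_measure hF.aestronglyMeasurable hpair.aemeasurable).2 ?_
    have : F ∘ (fun z : G × G => (z.1, z.1 * z.2)) = f := funext hrec
    rw [this]; exact hfi
  -- the fibre average is a strongly measurable, μ-integrable function of the coarse variable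
  set Ψ : G → ℝ := fun s => ∫ a, F (a, s) ∂μ with hΨ_def
  have hΨavg : ∀ s, axialPairAverage μ f s = Ψ s := fun s => rfl
  have hΨm : StronglyMeasurable Ψ := hF.stronglyMeasurable.integral_prod_left'
  have hΨi : Integrable Ψ μ := hFJ.integral_prod_right
  have hΨsd : Integrable (fun z : G × G => Ψ (z.1 * z.2)) μ2 := by
    have h1 : Integrable Ψ (μ2.map (fun z : G × G => z.1 * z.2)) := by rw [hsdπ]; exact hΨi
    exact (integrable_map_measure hΨm.aestronglyMeasurable hmul.aemeasurable).1 h1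
  have hm : MeasurableSpace.comap (fun z : G × G => z.1 * z.2) inferInstance
      ≤ (inferInstance : MeasurableSpace (G × G)) := hmul.comap_le
  have hsdm : Measurable[MeasurableSpace.comap (fun z : G × G => z.1 * z.2) inferInstance]
      (fun z : G × G => z.1 * z.2) :=
    measurable_iff_comap_le.2 le_rfl
  have hgm : StronglyMeasurable[MeasurableSpace.comap (fun z : G × G => z.1 * z.2) inferInstance]
      (fun z : G × G => Ψ (z.1 * z.2)) := hΨm.comp_measurable hsdm
  show condExp (MeasurableSpace.comap (fun z : G × G => z.1 * z.2) inferInstance) μ2 f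
      =ᵐ[μ2] fun z => axialPairAverage μ f (z.1 * z.2)
  simp only [hΨavg]
  refine (ae_eq_condExp_of_forall_setIntegral_eq hm hfi (fun s _ _ => hΨsd.integrableOn) ?_
    hgm.aestronglyMeasurable).symm
  rintro _ ⟨B, hB, rfl⟩ -
  -- both sides are `∫ 1_B(s) Ψ(s) dμ(s)`
  have hpre : MeasurableSet ((fun z : G × G => z.1 * z.2) ⁻¹' B) := hmul hB
  rw [← integral_indicator hpre, ← integral_indicator hpre]
  have lhs : ∫ z, ((fun z : G × G => z.1 * z.2) ⁻¹' B).indicator (fun z : G × G => Ψ (z.1 * z.2)) z ∂μ2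
      = ∫ s, B.indicator Ψ s ∂μ := by
    have h1 : ((fun z : G × G => z.1 * z.2) ⁻¹' B).indicator (fun z : G × G => Ψ (z.1 * z.2))
        = fun z : G × G => B.indicator Ψ (z.1 * z.2) := by
      funext z
      exact Set.indicator_comp_right (s := B) (fun z : G × G => z.1 * z.2) (g := Ψ) (x := z)
    rw [h1, ← hsdπ, integral_map hmul.aemeasurable]
    exact ((hΨm.indicator hB).aestronglyMeasurable)
  have rhs : ∫ z, ((fun z : G × G => z.1 * z.2) ⁻¹' B).indicator f z ∂μ2 = ∫ s, B.indicator Ψ s ∂μ := by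
    have h1 : ((fun z : G × G => z.1 * z.2) ⁻¹' B).indicator f
        = fun z : G × G => (Prod.snd ⁻¹' B : Set (G × G)).indicator F (z.1, z.1 * z.2) := by
      funext z
      by_cases hz : z.1 * z.2 ∈ B
      · have hz' : z ∈ (fun z : G × G => z.1 * z.2) ⁻¹' B := hz
        have hz'' : (z.1, z.1 * z.2) ∈ (Prod.snd ⁻¹' B : Set (G × G)) := hz
        rw [Set.indicator_of_mem hz', Set.indicator_of_mem hz'', hrec]
      · have hz' : z ∉ (fun z : G × G => z.1 * z.2) ⁻¹' B := hz
        have hz'' : (z.1, z.1 * z.2) ∉ (Prod.snd ⁻¹' B : Set (G × G)) := hz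
        rw [Set.indicator_of_notMem hz', Set.indicator_of_notMem hz'']
    have hBm : MeasurableSet (Prod.snd ⁻¹' B : Set (G × G)) := measurable_snd hB
    rw [h1, ← integral_map hpair.aemeasurable ((hF.indicator hBm).aestronglyMeasurable), hJ,
      integral_prod_symm _ (hFJ.indicator hBm)]
    refine integral_congr_ae (Filter.Eventually.of_forall (fun s => ?_))
    by_cases hs : s ∈ B
    · simp only [Set.indicator_of_mem hs, hΨ_def]
      refine integral_congr_ae (Filter.Eventually.of_forall (fun a => ?_))
      exact Set.indicator_of_mem (by exact hs) F
    · simp only [Set.indicator_of_notMem hs]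
      rw [← integral_zero (α := G) ℝ]
      refine integral_congr_ae (Filter.Eventually.of_forall (fun a => ?_))
      exact Set.indicator_of_notMem (by exact hs) F
  rw [lhs, rhs]

end Summit.Ventures.YMGap.YM3IR

end
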